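/-
Copyright (c) 2026 the pub-hodgecm-mathlib formalisation cell (harness21).  Prover seat hodgecm-mathlib-K2E3-p37 (g0), Track B «K2-LIT» ∕ h413 =
`stmt-HodgeConjecture-24833`, line `K2_E3_EllipticInputs`, unit U4 «Keys», PART «U4Keys» socket :182 (U4f-χ₁-ram-one-pos)
`sig_K2E3KeysThmTwoContractingRamifiedCharOnePosDepth` (LINE-LEAD K2E3-plan (g4) L4∕E3 EMIT #5 deal D163 2026-09-04T15:31:56Z; R0 census + §6 addendum
`K2/K2E3-p37/g0/CENSUS-U4f-PosDepth.K2E3-p37-g0.md`): programme A_pos brick (ii) «THE BIG CELL OF A LOWER UNIPOTENT, EXPLICITLY AND LEVEL-FREE» —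
`ū(x, z) = p · w · u(x∕z, 1∕z)` with `u(x∕z, 1∕z)` INTEGRAL as soon as `|z| ≥ 1`, hence in every level-`n` Iwahori `J_n`.  REPORT-FIRST 2026-09-04.
-/
import Summits.HodgeConjecture.HodgeConjecture.Theorems.K2E3IwahoriLevelNFactorisation   -- ★ p861548 (this seat): the level-`n` Iwahori `J_n`, its entry test `mem_glInt_inf_conj_glInt_pow_iff`; brings ★ `UnitaryBruhatIwahoriThree` ∕ `UnitaryIwahoriSubgroupThree` ∕ BigCell ∕ Iwasawa
import Summits.HodgeConjecture.HodgeConjecture.Theorems.K2E3LowerUnipotentBorelIwahori     -- ★ Z2A-3a (K2E3-p06 (g4)): `exists_coe_eq_lower_of_mem_map` (shape `ū(x, z)` of `N̄ = N.map (conj w)`)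
import HarnessLib

/-!
# K2 ∕ E3 «EllipticInputs», unit U4 «Keys» — (U4f-χ₁-ram-one-pos), programme A_pos brick (ii): THE BIG CELL OF A LOWER UNIPOTENT OF `U(σ, Φ₃)(K)`, EXPLICITLY
# «`ū(x, z) = p · w · u(x∕z, 1∕z)`, `p ∈ B`; `|z| ≥ 1 ⟹ u(x∕z, 1∕z) ∈ N ∩ K₀ ⊆ J_n` for every `n`»   [Casselman1995 Prop. 1.3.1; BruhatTits1972 (4.4.4); Rogawski1990 §1.10]

Cell hodgecm-mathlib, Track B «K2-LIT», crux item H413 = stmt-HodgeConjecture-24833 (route `HCCMUnconditional`, no route verbs); target BY NAME the OPEN tier-0 leaf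
`…K2E3EllipticInputs.U4Keys.sig_K2E3KeysThmTwoContractingRamifiedCharOnePosDepth` (U4Keys ED. 8 :182), design D-I «vanishing functional» at POSITIVE depth.  Author K2E3-p37 (g0).
`--supports stmt-HodgeConjecture-24833 --as helper`; THEOREMS ONLY (no `def` ∕ `instance` ∕ `notation` ∕ named fact ∕ `sorry`); MODEL level (`U(σ, Φ₃)(K)`, `σ` an isometric
involution; letters of ★ `UnitaryIwahoriSubgroupThree` ∕ ★ p861548: `hσ hvσ hvϖ hJ gn hgn`).  NOT THE PAYER of :182.

THE POINT.  At depth zero, ★ Z2A-3a `K2E3LowerUnipotentBorelIwahori` obtains the dichotomy «`n̄ ∈ I` or `n̄ ∈ P·w·I`» for a lower unipotent `n̄ ∈ N̄ = w N w` abstractly, from the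
Bruhat–Iwahori cover `U = P·I ⊔ P·w·I`; the `κ ∈ I` it produces need not lie in the smaller level-`n` Iwahori `J_n` of ★ p861548.  For the positive-depth engine ★ p861573
`K2E3BranchAContradictionCells` (cell family `R = N̄ ∖ J_n`) one needs the big cell QUANTITATIVELY: here `n̄ = ū(x, z)` (`z + σz + xσx = 0`, ★ `exists_coe_eq_lower_of_mem_map`)
with `z ≠ 0` is factorised EXPLICITLY as **`ū(x, z) = p · w · u(x∕z, 1∕z)`**, `p ∈ B` (solve `p·ū ∈ w·N` row by row: `p = ū · u(x∕z,1∕z)⁻¹ · w`, whose three strictly-lower entries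
`σ(x∕z) − σx·σ(1∕z)`, `z·σ(1∕z) + x·σ(x∕z) + 1 = (z + σz + xσx)∕σz`, `x − z·(x∕z)` vanish), and the right factor `u(x∕z, 1∕z)` is INTEGRAL as soon as `|z| ≥ 1` (`|1∕z| ≤ 1`;
`|x| ≤ |z|` from `|x|² ≤ |z|`, ★ `v_le_v_of_rel` ∕ `v_le_one_of_rel`) — so `n̄ ∈ P·w·(N ∩ K₀) ⊆ P·w·J_n` for EVERY `n` (an integral upper unitriangular unitary passes the
level-`n` test ★ `mem_glInt_inf_conj_glInt_pow_iff` trivially).  Consequently the depth-zero Branch-A witness on the big cell TRANSPORTS to every level (addendum §6 (A) of the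
census); the intermediate regime `|z| < 1`, `n̄ ∉ J_n` (depth witnesses) is brick (iii).
* §1 (any field) `exists_upper_of_rel` (the element `u(a, b) ∈ N` with prescribed coordinates, as `w·ū(a, b)·w`), `div_rel` (the relation for `(x∕z, 1∕z)`),
  **`exists_borel_mul_weylLongU_mul_upper`** (`ū(x, z) = p · w · u(x∕z, 1∕z)`, `p ∈ B`, `u ∈ N`).
* §2 (valued) `v_div_le_one_of_rel` (`|x∕z| ≤ 1` for `|z| ≥ 1`), **`exists_borel_mul_weylLongU_mul_integralUpper`** (`|n̄₂₀| ≥ 1 ⟹ n̄ = p·w·u`, `u ∈ N ∩ K₀`),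
  `mem_inf_pow_of_mem_unipotentU_of_mem_glInt` (`N ∩ K₀ ≤ J_n`), **`exists_borel_mul_weylLongU_mul_mem_inf_pow`** (`|n̄₂₀| ≥ 1 ⟹ n̄ ∈ P·w·J_n`, every `n`).
HONEST LABEL: HC_CM is proved only modulo the 7 printed citations (2 remaining named inputs: hLiu418 = stmt-HodgeConjecture-24832, h413 = stmt-HodgeConjecture-24833)
until rung 0 closes; count-neutral — this file does NOT pay the leaf; no printed citation is discharged.

## References
* [Casselman1995] W. Casselman, *Introduction to the theory of admissible representations of `p`-adic reductive groups* (1995), Prop. 1.3.1 (Bruhat decomposition), Prop. 1.4.4.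
* [BruhatTits1972] F. Bruhat, J. Tits, *Groupes réductifs sur un corps local I*, Publ. Math. IHÉS 41 (1972), (4.4.3)–(4.4.4).
* [Rogawski1990] J. D. Rogawski, *Automorphic Representations of Unitary Groups in Three Variables*, Ann. of Math. Stud. 123 (1990), §1.9–§1.10 pp. 8–9.
* [Serre1979] J.-P. Serre, *Local Fields*, GTM 67 (1979), Ch. II §1 (the ultrametric inequality).
-/

set_option autoImplicit false
-- the mandated namespace repeats the single-problem summit's segment (`HodgeConjecture.HodgeConjecture`)
set_option linter.dupNamespace false

noncomputable section

open Matrix Literature.NumberTheory.Automorphic Literature.NumberTheory.Automorphic.UnitaryGroup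
open scoped Matrix MatrixGroups WithZero Pointwise

namespace Summit.HodgeConjecture.HodgeConjecture.Cruxes.H413.K2E3LowerUnipotentBigCellIntegral

open Summit.HodgeConjecture.HodgeConjecture.Cruxes.H413

/-! ## §1 Algebra over a field: `ū(x, z) = p · w · u(x∕z, 1∕z)` -/

section Algebra

variable {K : Type*} [Field K] (σ : K →+* K) {J : Matrix (Fin 3) (Fin 3) K} (hJ : J = (StdForm.antidiagonal 3).over K)
  (hσ : ∀ a, σ (σ a) = a)

include hJ hσ in
/-- **The element `u(a, b) ∈ N` with prescribed coordinates**: for `b + σb + aσa = 0` there is `u ∈ N` with matrix `!![1, a, b; 0, 1, -σ a; 0, 0, 1]` — namely `w · ū(a, b) · w`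
(★ `exists_coe_eq_lower`, ★ `coe_weylLongU_mul_mul_weylLongU_apply'`). [cite: Rogawski1990, §1.10 p. 9] -/
theorem exists_upper_of_rel {a b : K} (hrel : b + σ b + a * σ a = 0) :
    ∃ u : ↥(unitaryGroupOfForm σ J), u ∈ unipotentU σ J ∧ ((u : GL (Fin 3) K) : Matrix (Fin 3) (Fin 3) K) = !![1, a, b; 0, 1, -σ a; 0, 0, 1] := by
  obtain ⟨k, hk⟩ := exists_coe_eq_lower σ hJ hσ hrel
  have hlow : ∀ i j : Fin 3, i < j → ((k : GL (Fin 3) K) : Matrix (Fin 3) (Fin 3) K) i j = 0 := by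
    intro i j hij; rw [hk]; fin_cases i <;> fin_cases j <;> simp at hij ⊢
  have hdiag : ∀ i : Fin 3, ((k : GL (Fin 3) K) : Matrix (Fin 3) (Fin 3) K) i i = 1 := by
    intro i; rw [hk]; fin_cases i <;> simp
  refine ⟨weylLongU σ hJ * k * weylLongU σ hJ, weylLongU_mul_mul_weylLongU_mem_unipotentU σ hJ hlow hdiag, ?_⟩
  ext i j
  rw [coe_weylLongU_mul_mul_weylLongU_apply' σ hJ k i j, hk]
  fin_cases i <;> fin_cases j <;> rfl

/-- **The relation for the big-cell coordinates**: if `z + σz + xσx = 0` and `z ≠ 0` then `1∕z + σ(1∕z) + (x∕z)σ(x∕z) = 0` (divide by `z σz`). [cite: Rogawski1990, §1.10 p. 9] -/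
theorem div_rel {x z : K} (hrel : z + σ z + x * σ x = 0) (hz : z ≠ 0) :
    z⁻¹ + σ z⁻¹ + x / z * σ (x / z) = 0 := by
  have hσz : σ z ≠ 0 := (map_ne_zero σ).2 hz
  rw [map_inv₀, map_div₀]
  field_simp
  linear_combination hrel

include hJ hσ in
set_option maxHeartbeats 800000 in
-- three `Fin.sum_univ_three` entry computations for `p = ū · u⁻¹ · w`
/-- **THE BIG CELL OF A LOWER UNIPOTENT, EXPLICITLY.**  For `n̄ ∈ U(σ, Φ₃)` with matrix `ū(x, z) = !![1, 0, 0; -σ x, 1, 0; z, x, 1]` (`z + σz + xσx = 0`) and `z ≠ 0`: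
`n̄ = p · w · u` with `p ∈ B` (upper triangular) and `u ∈ N` of matrix `u(x∕z, 1∕z)`.  Proof: `u` from `exists_upper_of_rel` ∕ `div_rel`; `p := n̄ u⁻¹ w` (so `p w u = n̄` as
`w² = 1`); the strictly-lower entries of `p` are `Σ_l n̄_{il} σ(u_{j, rev l})` (★ `coe_inv_apply_eq`, ★ `coe_mul_weylLongU_apply`): `(1,0) ↦ σ(x∕z) − σx σ(1∕z) = 0`,
`(2,0) ↦ z σ(1∕z) + x σ(x∕z) + 1 = (σz + xσx + z)∕σz = 0`, `(2,1) ↦ −z σσ(x∕z) + x = 0`. [cite: Casselman1995, Prop. 1.3.1] [cite: Rogawski1990, §1.10 p. 9] -/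
theorem exists_borel_mul_weylLongU_mul_upper {nb : ↥(unitaryGroupOfForm σ J)} {x z : K}
    (hnb : ((nb : GL (Fin 3) K) : Matrix (Fin 3) (Fin 3) K) = !![1, 0, 0; -σ x, 1, 0; z, x, 1]) (hrel : z + σ z + x * σ x = 0) (hz : z ≠ 0) :
    ∃ p u : ↥(unitaryGroupOfForm σ J), p ∈ borelU σ J ∧ u ∈ unipotentU σ J ∧
      ((u : GL (Fin 3) K) : Matrix (Fin 3) (Fin 3) K) = !![1, x / z, z⁻¹; 0, 1, -σ (x / z); 0, 0, 1] ∧ nb = p * weylLongU σ hJ * u := by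
  have hσz : σ z ≠ 0 := (map_ne_zero σ).2 hz
  obtain ⟨u, huN, hu⟩ := exists_upper_of_rel σ hJ hσ (div_rel σ hrel hz)
  have hw : weylLongU σ hJ * weylLongU σ hJ = 1 := weylLongU_mul_weylLongU σ hJ
  refine ⟨nb * u⁻¹ * weylLongU σ hJ, u, ?_, huN, hu, ?_⟩
  · -- `p = n̄ u⁻¹ w` is upper triangular
    -- entries of the factors
    have e00 : ((u : GL (Fin 3) K) : Matrix (Fin 3) (Fin 3) K) 0 0 = 1 := by rw [hu]; rfl
    have e01 : ((u : GL (Fin 3) K) : Matrix (Fin 3) (Fin 3) K) 0 1 = x / z := by rw [hu]; rfl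
    have e02 : ((u : GL (Fin 3) K) : Matrix (Fin 3) (Fin 3) K) 0 2 = z⁻¹ := by rw [hu]; rfl
    have e10 : ((u : GL (Fin 3) K) : Matrix (Fin 3) (Fin 3) K) 1 0 = 0 := by rw [hu]; rfl
    have e11 : ((u : GL (Fin 3) K) : Matrix (Fin 3) (Fin 3) K) 1 1 = 1 := by rw [hu]; rfl
    have e12 : ((u : GL (Fin 3) K) : Matrix (Fin 3) (Fin 3) K) 1 2 = -σ (x / z) := by rw [hu]; rfl
    have n10 : ((nb : GL (Fin 3) K) : Matrix (Fin 3) (Fin 3) K) 1 0 = -σ x := by rw [hnb]; rfl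
    have n11 : ((nb : GL (Fin 3) K) : Matrix (Fin 3) (Fin 3) K) 1 1 = 1 := by rw [hnb]; rfl
    have n12 : ((nb : GL (Fin 3) K) : Matrix (Fin 3) (Fin 3) K) 1 2 = 0 := by rw [hnb]; rfl
    have n20 : ((nb : GL (Fin 3) K) : Matrix (Fin 3) (Fin 3) K) 2 0 = z := by rw [hnb]; rfl
    have n21 : ((nb : GL (Fin 3) K) : Matrix (Fin 3) (Fin 3) K) 2 1 = x := by rw [hnb]; rfl
    have n22 : ((nb : GL (Fin 3) K) : Matrix (Fin 3) (Fin 3) K) 2 2 = 1 := by rw [hnb]; rfl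
    -- `(n̄ u⁻¹ w)_{ij} = Σ_l n̄_{il} σ(u_{j, rev l})`
    have hinv : ∀ i j, (((u⁻¹ : ↥(unitaryGroupOfForm σ J)) : GL (Fin 3) K) : Matrix (Fin 3) (Fin 3) K) i j =
        σ (((u : GL (Fin 3) K) : Matrix (Fin 3) (Fin 3) K) (Fin.rev j) (Fin.rev i)) := fun i j => coe_inv_apply_eq σ hJ u i j
    have hentry : ∀ i j, (((nb * u⁻¹ * weylLongU σ hJ : ↥(unitaryGroupOfForm σ J)) : GL (Fin 3) K) : Matrix (Fin 3) (Fin 3) K) i j =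
        ∑ l, ((nb : GL (Fin 3) K) : Matrix (Fin 3) (Fin 3) K) i l * σ (((u : GL (Fin 3) K) : Matrix (Fin 3) (Fin 3) K) j (Fin.rev l)) := by
      intro i j
      rw [coe_mul_weylLongU_apply σ hJ, Subgroup.coe_mul, Units.val_mul, Matrix.mul_apply]
      refine Finset.sum_congr rfl fun l _ => ?_
      rw [hinv, Fin.rev_rev]
    have r0 : Fin.rev (0 : Fin 3) = 2 := rfl
    have r1 : Fin.rev (1 : Fin 3) = 1 := rfl
    have r2 : Fin.rev (2 : Fin 3) = 0 := rfl
    have p10 : (((nb * u⁻¹ * weylLongU σ hJ : ↥(unitaryGroupOfForm σ J)) : GL (Fin 3) K) : Matrix (Fin 3) (Fin 3) K) 1 0 = 0 := by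
      rw [hentry, Fin.sum_univ_three, r0, r1, r2, n10, n11, n12, e02, e01, e00, map_inv₀, map_div₀]
      field_simp
      ring
    have p20 : (((nb * u⁻¹ * weylLongU σ hJ : ↥(unitaryGroupOfForm σ J)) : GL (Fin 3) K) : Matrix (Fin 3) (Fin 3) K) 2 0 = 0 := by
      rw [hentry, Fin.sum_univ_three, r0, r1, r2, n20, n21, n22, e02, e01, e00, map_inv₀, map_div₀, map_one]
      field_simp
      linear_combination hrel
    have p21 : (((nb * u⁻¹ * weylLongU σ hJ : ↥(unitaryGroupOfForm σ J)) : GL (Fin 3) K) : Matrix (Fin 3) (Fin 3) K) 2 1 = 0 := by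
      rw [hentry, Fin.sum_univ_three, r0, r1, r2, n20, n21, n22, e12, e11, e10, map_neg, hσ, map_one, map_zero]
      field_simp
      ring
    rw [mem_borelU_iff]
    intro i j hij
    fin_cases i <;> fin_cases j
    all_goals first | exact absurd hij (by decide) | exact p10 | exact p20 | exact p21
  · rw [mul_assoc, mul_assoc, ← mul_assoc (weylLongU σ hJ), hw, one_mul, inv_mul_cancel_right]

end Algebra

/-! ## §2 Valuations: `|z| ≥ 1 ⟹ u(x∕z, 1∕z)` is integral, hence in every `J_n` -/

section Valuation

variable {K : Type*} [Field K] [Valued K ℤᵐ⁰] [ValuativeRel K] [(Valued.v : Valuation K ℤᵐ⁰).Compatible]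
  (σ : K →+* K) {ϖ : K} {J : Matrix (Fin 3) (Fin 3) K} (hJ : J = (StdForm.antidiagonal 3).over K)
  (hσ : ∀ a, σ (σ a) = a) (hvσ : ∀ a, Valued.v (σ a) = Valued.v a) (hvϖ : Valued.v ϖ = WithZero.exp (-1 : ℤ))
  {n : ℕ} (gn : GL (Fin 3) K) (hgn : (gn : Matrix (Fin 3) (Fin 3) K) = Matrix.diagonal ![(1 : K), 1, ϖ ^ n])

omit [ValuativeRel K] [(Valued.v : Valuation K ℤᵐ⁰).Compatible] in
include hvσ in
/-- **`|x∕z| ≤ 1` when `|z| ≥ 1`** on `N̄` (`z + σz + xσx = 0` gives `|x|² ≤ |z|`: ★ `v_le_v_of_rel` for `|z| > 1`, ★ `v_le_one_of_rel` for `|z| = 1`).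
[cite: Serre1979, Ch. II §1] [cite: Rogawski1990, §1.10 p. 9] -/
theorem v_div_le_one_of_rel {x z : K} (hrel : z + σ z + x * σ x = 0) (hz : 1 ≤ Valued.v z) : Valued.v (x / z) ≤ 1 := by
  have hz0 : Valued.v z ≠ 0 := ne_of_gt (lt_of_lt_of_le zero_lt_one hz)
  rw [map_div₀, div_le_one₀ (zero_lt_iff.2 hz0)]
  rcases hz.lt_or_eq with hlt | heq
  · exact v_le_v_of_rel σ hvσ hrel hlt
  · rw [← heq]; exact v_le_one_of_rel σ hvσ hrel (le_of_eq heq.symm)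

include hJ hσ hvσ in
/-- **`|n̄₂₀| ≥ 1 ⟹ n̄ = p · w · u` with `u ∈ N ∩ K₀` INTEGRAL**, for a lower unipotent `n̄ ∈ N̄ = N.map (conj w)` (shape ★ `exists_coe_eq_lower_of_mem_map`; §1 with `z = n̄₂₀ ≠ 0`;
`u(x∕z, 1∕z)` integral by `v_div_le_one_of_rel` and `|1∕z| ≤ 1`, ★ `mem_glInt_of_coe_eq`). [cite: Casselman1995, Prop. 1.3.1] [cite: BruhatTits1972, (4.4.4)] -/
theorem exists_borel_mul_weylLongU_mul_integralUpper {nb : ↥(unitaryGroupOfForm σ J)}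
    (hnb : nb ∈ ((borelTriple σ J hJ).N).map (MulAut.conj (weylLongU σ hJ)).toMonoidHom)
    (hz : 1 ≤ Valued.v (((nb : GL (Fin 3) K) : Matrix (Fin 3) (Fin 3) K) 2 0)) :
    ∃ p u : ↥(unitaryGroupOfForm σ J), p ∈ borelU σ J ∧ u ∈ unipotentU σ J ∧
      u ∈ (glInt 3 K).subgroupOf (unitaryGroupOfForm σ J) ∧ nb = p * weylLongU σ hJ * u := by
  obtain ⟨x, z, hnbv, hrel⟩ := K2E3LowerUnipotentBorelIwahori.exists_coe_eq_lower_of_mem_map σ hJ hσ hnb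
  have h20 : ((nb : GL (Fin 3) K) : Matrix (Fin 3) (Fin 3) K) 2 0 = z := by rw [hnbv]; rfl
  rw [h20] at hz
  have hz0 : z ≠ 0 := fun h => by
    rw [h, map_zero] at hz
    exact absurd hz (not_le.2 zero_lt_one)
  obtain ⟨p, u, hp, huN, hu, he⟩ := exists_borel_mul_weylLongU_mul_upper σ hJ hσ hnbv hrel hz0
  refine ⟨p, u, hp, huN, ?_, he⟩
  -- the three non-trivial entries of `u(x∕z, 1∕z)`, in `simp`-normal form
  have hxz : Valued.v x / Valued.v z ≤ 1 := by rw [← map_div₀]; exact v_div_le_one_of_rel σ hvσ hrel hz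
  have hzi : (Valued.v z)⁻¹ ≤ 1 := inv_le_one_of_one_le₀ hz
  have hσxz : Valued.v (σ x) / Valued.v (σ z) ≤ 1 := by rw [hvσ, hvσ]; exact hxz
  exact Subgroup.mem_subgroupOf.2 (mem_glInt_of_coe_eq σ hJ hvσ hu fun i j => by
    fin_cases i <;> fin_cases j <;> simp [hxz, hzi, hσxz])

include hJ hvσ hvϖ hgn in
/-- **`N ∩ K₀ ≤ J_n` for every `n`**: an integral UPPER unitriangular unitary passes the level-`n` test (★ `mem_glInt_inf_conj_glInt_pow_iff`) since its three strictly-lower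
entries vanish. [cite: BruhatTits1972, (4.4.4)] [cite: Casselman1995, Prop. 1.4.4] -/
theorem mem_inf_pow_of_mem_unipotentU_of_mem_glInt {u : ↥(unitaryGroupOfForm σ J)} (hu : u ∈ unipotentU σ J)
    (hu0 : u ∈ (glInt 3 K).subgroupOf (unitaryGroupOfForm σ J)) :
    u ∈ (glInt 3 K).subgroupOf (unitaryGroupOfForm σ J) ⊓ ((glInt 3 K).map (MulAut.conj gn).toMonoidHom).subgroupOf (unitaryGroupOfForm σ J) := by
  obtain ⟨htri, -⟩ := (mem_unipotentU_iff u).1 hu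
  rw [K2E3IwahoriLevelNFactorisation.mem_glInt_inf_conj_glInt_pow_iff σ hJ hvσ hvϖ gn hgn]
  refine ⟨(mem_glInt_subgroupOf_iff σ hJ hvσ u).1 hu0, ?_, ?_, ?_⟩
  · rw [htri (show ((id 0 : Fin 3)) < id 2 by decide), map_zero]; exact zero_le
  · rw [htri (show ((id 1 : Fin 3)) < id 2 by decide), map_zero]; exact zero_le
  · rw [htri (show ((id 0 : Fin 3)) < id 1 by decide), map_zero]; exact zero_le

include hJ hσ hvσ hvϖ hgn in
/-- **`|n̄₂₀| ≥ 1 ⟹ n̄ ∈ P · w · J_n` for EVERY level `n`** (the big cell of the level-`n` cell family of ★ p861573: there the type vector vanishes by the Branch-A witness,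
transported from `w` along `p` and `u`). [cite: Casselman1995, Prop. 1.3.1] [cite: BruhatTits1972, (4.4.4)] [cite: Rogawski1990, §1.10 p. 9] -/
theorem exists_borel_mul_weylLongU_mul_mem_inf_pow {nb : ↥(unitaryGroupOfForm σ J)}
    (hnb : nb ∈ ((borelTriple σ J hJ).N).map (MulAut.conj (weylLongU σ hJ)).toMonoidHom)
    (hz : 1 ≤ Valued.v (((nb : GL (Fin 3) K) : Matrix (Fin 3) (Fin 3) K) 2 0)) :
    ∃ p ∈ borelU σ J, ∃ u ∈ (glInt 3 K).subgroupOf (unitaryGroupOfForm σ J) ⊓ ((glInt 3 K).map (MulAut.conj gn).toMonoidHom).subgroupOf (unitaryGroupOfForm σ J),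
      nb = p * weylLongU σ hJ * u := by
  obtain ⟨p, u, hp, huN, hu0, he⟩ := exists_borel_mul_weylLongU_mul_integralUpper σ hJ hσ hvσ hnb hz
  exact ⟨p, hp, u, mem_inf_pow_of_mem_unipotentU_of_mem_glInt σ hJ hvσ hvϖ gn hgn huN hu0, he⟩

end Valuation

end Summit.HodgeConjecture.HodgeConjecture.Cruxes.H413.K2E3LowerUnipotentBigCellIntegral

end
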